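import Summits.QuantumFields.YangMills.Theorems.OnsetSkewLawRPOnsetFloorCoarseCollar
import Summits.QuantumFields.YangMills.Theorems.OnsetSkewLawRPOnsetFloorOSPigeonholeCone
import Summits.QuantumFields.YangMills.Theorems.OnsetSkewLawRPOnsetFloorAdmBumpInhabited
import Summits.QuantumFields.YangMills.Theorems.OnsetSkewLawRPOnsetFloorSchwartzFlat
import HarnessLib

/-!
# Cruxes `OnsetSkewLaw.RPOnsetFloor` (stmt-QuantumFields-23138) and `MarkovAtoms.OnsetFloor` (stmt-QuantumFields-22956): the
# SHARED load-bearing stub `stub_coarseCollarAtomRPFloor` BY NAME — steps S1 + S2 (the cross-floor datum) and the assembly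

LINES «FloorInheritance» v5 (sha 09e801d0) and «MarkovFloorInheritance» v3 (sha a4a257d4) of planner ym-idea-11 g13 share VERBATIM
the registered stub `stub_coarseCollarAtomRPFloor : StubCoarseCollarP`.  The generic tail S3–S8 is the tree theorem
`RPOnsetFloorCoarseCollar.coarseCollar_of_crossFloor : CrossFloorAtomsP → StubCoarseCollarP` (`OnsetSkewLawRPOnsetFloorCoarseCollar.lean`).
THIS FILE PROVES `CrossFloorAtomsP` (S1 + S2) and hence the stub:

* §1 bookkeeping: the canonical admissible bump `(bump, 5, 8)` (`admBump_bump_five_eight`, the witness of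
  `OnsetSkewLawRPOnsetFloorAdmBump.admBump_inhabited` with its values exposed), the site count `card_atomSites_le`, the `ℓ¹`
  Fubini `tsum_expand_atoms` (an `ℓ¹` family of finitely supported bounded weights against a bounded field: majorant summable by
  `summable_prod_of_nonneg`, then `Summable.tsum_comm`), masses over a finite first factor `summable_abs_snd`;
* §2 the vector identities putting the synthesis atoms `b(σ⁻¹(· − η))` sampled at base sites / shifted base sites into the crux's
  centre-coordinate form `b(s_I(x + o_q) − y_I)` with `s_I = s/σ`, `y_I = η/σ + s_I o_q` (`A`-side) and
  `y_I = η/σ + s_I(o_q − ℓ_q)` (`B′`-side), and `(o_q)₀ − ℓ_q,₀ ∈ [−1/2, 0]` for valid `q`;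
* §3 ★ `crossFloorDatum_of_synthesis`: for an SU(2)-class `G`, the residual `OnsetFloorQ2` gives `r`, a positive-time Schwartz `v`,
  `ε > 0` and per `β ≥ β₅` a resolution `s ∈ (0,1]` with the torus floor, which `OSPigeonhole.coneCrossFloor_of_torusFloor` (✓ tree,
  S1 + S2a) turns into the cone cross floor `ε ≤ Cov_μ(B′_{v,s}∘Θ, A_{v,s})`; the collar synthesis (H1) for `(bump, 5, 8)` — its
  flatness input supplied by `schwartz_flat_of_tsupport_pos` (✓ tree) — writes `v = Σ coefᵢ b(σᵢ⁻¹(· − ηᵢ))`, `Σ|coefᵢ| ≤ C M_v`,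
  `σᵢ ∈ (0,1]`, `8σᵢ ≤ ηᵢ,₀`; expanding `A_{v,s}` (`smear_eq_sum_tsum_plane`) and `B′_{v,s}` (`smearR`) atom by atom gives the two
  families over `{q // q.1 < q.2} × ℕ` with the per-atom clauses of `CrossFloorDatum` by arithmetic (heights `≥ 8`, resp.
  `≥ 8 − s_I/2`; collar `6 + 9 s_I ≤ 2y₀ + 8` for `s_I ≤ 1`); then `crossFloorAtoms : CrossFloorAtomsP` and
  ★★ **`stub_coarseCollarAtomRPFloor : StubCoarseCollarP := coarseCollar_of_crossFloor crossFloorAtoms`** — the registered stub of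
  BOTH lines by name + signature (checked: replacing the skeletons' `sorry` by this constant elaborates in LINE 2 v5 and LINE 3 v3,
  standard axioms).

WHAT THIS DOES AND DOES NOT CLOSE: the stub is an IMPLICATION whose hypotheses are the lines' other inputs — the collar synthesis
`(∀ b R₀ t, AdmBump b R₀ t → ∃ C N, 0 ≤ C ∧ PosTimeSynthC b C N)` (= `stub_singleSlot` [L] + `stub_positiveTimeSynthesisCollar`
[M/L], OPEN), `StubUVQuietP` (✓ tree) and the residual `OnsetFloorQ2` (OPEN, = the two-point conjunct of `OnsetFloors`, NT-class).
So after this file LINE 2's skeleton is open exactly at {singleSlot, positiveTimeSynthesisCollar, onsetFloorQ2} and LINE 3's at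
{singleSlot, positiveTimeSynthesisCollar, uvQuietVar?, onsetFloorQ2} per their registries; no crux, rung or summit is proved; the
Yang–Mills mass gap is NOT proved.  Cell `ym-idea-1`, width seat `ym-line-sfw-p2-w5` g16 (free hands), planner ym-idea-11 g13's GO
(cell STATUS 2026-08-29T04:23:44Z), statement ACKs idea-crit-9 #75f/#75g. [folklore]
-/

set_option autoImplicit false

noncomputable section

open scoped BigOperators
open MeasureTheory ProbabilityTheory Filter Topology
open Literature.MathematicalPhysics.QuantumFieldTheory Literature.MathematicalPhysics.QuantumLattice
open Literature.Probability.LatticeModels (Site)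
open Summit.QuantumFields.YangMills.Cruxes.OSLegsFromFemtoAndGap.DlrCollarTransfer (plane continuous_plane)
open Summit.QuantumFields.YangMills.Theorems.InfiniteVolume (stateMomentStr summable_abs_schwartz_lattice)
open Summit.QuantumFields.YangMills.Theorems.InfVolRP (centreOffset two_mul_centreOffset_zero centreOffset_time)
open Summit.QuantumFields.YangMills.Theorems.RPOnsetFloorCellShift (AdmBump)
open Summit.QuantumFields.YangMills.Theorems.OnsetSkewLawRPOnsetFloorOSPigeonhole (smear smearR layerShift
  smear_eq_sum_tsum_plane coneCrossFloor_of_torusFloor)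
open Summit.QuantumFields.YangMills.Theorems.MarkovAtomsOnsetFloorMarkovTail (atomSites weight_eq_zero_of_not_mem
  abs_bumpAtom_le)
open Summit.QuantumFields.YangMills.Theorems.OnsetSkewLawRPOnsetFloorAdmBump (bumpFn coe_bump bump_apply
  bumpFn_hasCompactSupport tsupport_bumpFn_subset prof_four_pos bumpFn_continuous bumpFn_nonneg prof_symm)
open Summit.QuantumFields.YangMills.Theorems.OnsetSkewLawGlue (abs_plane_le_N)

namespace Summit.QuantumFields.YangMills.Theorems.RPOnsetFloorCoarseCollar

/-! ## §1 Generic bookkeeping -/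

/-- The canonical admissible collar bump `(bump, 5, 8)` of `OnsetSkewLawRPOnsetFloorAdmBump` (its `admBump_inhabited` only
exports the existential; the collar arithmetic below needs the values `R₀ = 5`, `t = 8`). [folklore] -/
theorem admBump_bump_five_eight : AdmBump OnsetSkewLawRPOnsetFloorAdmBump.bump 5 8 := by
  refine ⟨?_, ?_, ?_, ?_, ?_, ?_⟩
  · rw [coe_bump]; exact bumpFn_hasCompactSupport
  · rw [coe_bump]
    intro u hu j
    obtain ⟨h1, h2⟩ := tsupport_bumpFn_subset hu j
    exact ⟨by linarith, h2⟩
  · rw [coe_bump]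
    intro u hu
    have := (tsupport_bumpFn_subset hu 0).1
    show 0 < u 0
    linarith
  · rw [coe_bump]
    have hc : bumpFn (WithLp.toLp 2 fun _ : Fin 4 => (4 : ℝ)) ≠ 0 := by
      simp only [bumpFn, Finset.prod_const, Finset.card_univ, Fintype.card_fin]
      exact (pow_pos prof_four_pos 4).ne'
    exact (bumpFn_continuous.integral_pos_of_hasCompactSupport_nonneg_nonzero bumpFn_hasCompactSupport
      bumpFn_nonneg hc).ne'
  · intro π u
    simp only [bump_apply, bumpFn]
    exact Equiv.prod_comp π (fun i => OnsetSkewLawRPOnsetFloorAdmBump.prof (u i))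
  · intro u
    simp only [bump_apply, bumpFn]
    refine Finset.prod_congr rfl fun k _ => ?_
    split_ifs with hk
    · exact prof_symm _
    · rfl

/-- The site count of an atom of spacing `s ≥ s₀`: `#atomSites R₀ s y ≤ (⌈R₀/s₀⌉₊ + 1)⁴`. [folklore] -/
theorem card_atomSites_le {R₀ s₀ s : ℝ} (hR₀ : 0 ≤ R₀) (hs₀ : 0 < s₀) (hs : s₀ ≤ s) (y : EuclideanSpace ℝ (Fin 4)) :
    (atomSites R₀ s y).card ≤ (⌈R₀ / s₀⌉₊ + 1) ^ 4 := by
  have h1 : (atomSites R₀ s y).card = (⌈R₀ / s⌉₊ + 1) ^ 4 := by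
    rw [atomSites, Fintype.card_piFinset]
    have hx : ∀ x : Fin 4, (Finset.Icc ⌊y x / s⌋ (⌊y x / s⌋ + ⌈R₀ / s⌉₊)).card = ⌈R₀ / s⌉₊ + 1 := fun x => by
      rw [Int.card_Icc]; omega
    simp only [hx, Finset.prod_const, Finset.card_univ, Fintype.card_fin]
  rw [h1]
  exact Nat.pow_le_pow_left (by have := Nat.ceil_le_ceil (div_le_div_of_nonneg_left hR₀ hs₀ hs); omega) 4

/-- **Fubini for an `ℓ¹` family of finitely supported bounded weights against a bounded field**:
`Σ'_x (Σ'_i cᵢ Wᵢ(x)) P(x) = Σ'_i cᵢ Σ'_x Wᵢ(x) P(x)`. [folklore] -/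
theorem tsum_expand_atoms {coef : ℕ → ℝ} (hcoef : Summable fun i => |coef i|) {W : ℕ → (Fin 4 → ℤ) → ℝ} {Mb : ℝ}
    (hW : ∀ i x, |W i x| ≤ Mb) (S : ℕ → Finset (Fin 4 → ℤ)) (hWS : ∀ i x, x ∉ S i → W i x = 0) {Cmax : ℕ}
    (hS : ∀ i, (S i).card ≤ Cmax) {P : (Fin 4 → ℤ) → ℝ} {NP : ℝ} (hP : ∀ x, |P x| ≤ NP) :
    (∑' x : Fin 4 → ℤ, (∑' i, coef i * W i x) * P x) = ∑' i, coef i * ∑' x : Fin 4 → ℤ, W i x * P x := by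
  have hMb0 : 0 ≤ Mb := (abs_nonneg _).trans (hW 0 0)
  have hNP0 : 0 ≤ NP := (abs_nonneg _).trans (hP 0)
  set f : ℕ → (Fin 4 → ℤ) → ℝ := fun i x => coef i * (W i x * P x) with hf
  -- the majorant
  have hg_row : ∀ i, Summable fun x : Fin 4 → ℤ => |coef i| * (|W i x| * NP) := fun i =>
    summable_of_ne_finset_zero (s := S i) fun x hx => by rw [hWS i x hx, abs_zero, zero_mul, mul_zero]
  have hg_tsum : ∀ i, ∑' x : Fin 4 → ℤ, |coef i| * (|W i x| * NP) ≤ |coef i| * ((Cmax : ℝ) * Mb * NP) := by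
    intro i
    rw [tsum_eq_sum (s := S i) (fun x hx => by rw [hWS i x hx, abs_zero, zero_mul, mul_zero]), ← Finset.mul_sum]
    refine mul_le_mul_of_nonneg_left ?_ (abs_nonneg _)
    calc ∑ x ∈ S i, |W i x| * NP ≤ ∑ _x ∈ S i, Mb * NP :=
          Finset.sum_le_sum fun x _ => mul_le_mul_of_nonneg_right (hW i x) hNP0
      _ = (S i).card * (Mb * NP) := by rw [Finset.sum_const, nsmul_eq_mul]
      _ ≤ (Cmax : ℝ) * (Mb * NP) := mul_le_mul_of_nonneg_right (by exact_mod_cast hS i) (mul_nonneg hMb0 hNP0)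
      _ = (Cmax : ℝ) * Mb * NP := by ring
  have hg : Summable fun p : ℕ × (Fin 4 → ℤ) => |coef p.1| * (|W p.1 p.2| * NP) := by
    refine (summable_prod_of_nonneg fun p => mul_nonneg (abs_nonneg _) (mul_nonneg (abs_nonneg _) hNP0)).2
      ⟨hg_row, ?_⟩
    exact Summable.of_nonneg_of_le (fun i => tsum_nonneg fun x => mul_nonneg (abs_nonneg _)
      (mul_nonneg (abs_nonneg _) hNP0)) hg_tsum (hcoef.mul_right _)
  have hfs : Summable (Function.uncurry f) := by
    refine Summable.of_norm_bounded (g := fun p : ℕ × (Fin 4 → ℤ) => |coef p.1| * (|W p.1 p.2| * NP)) hg fun p => ?_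
    obtain ⟨i, x⟩ := p
    rw [Function.uncurry_apply_pair, Real.norm_eq_abs]
    show |coef i * (W i x * P x)| ≤ |coef i| * (|W i x| * NP)
    rw [abs_mul, abs_mul]
    exact mul_le_mul_of_nonneg_left (mul_le_mul_of_nonneg_left (hP x) (abs_nonneg _)) (abs_nonneg _)
  calc (∑' x : Fin 4 → ℤ, (∑' i, coef i * W i x) * P x) = ∑' x : Fin 4 → ℤ, ∑' i, f i x := by
        refine tsum_congr fun x => ?_
        rw [← tsum_mul_right]
        exact tsum_congr fun i => by simp only [hf]; ring
    _ = ∑' i, ∑' x : Fin 4 → ℤ, f i x := hfs.tsum_comm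
    _ = ∑' i, coef i * ∑' x : Fin 4 → ℤ, W i x * P x := tsum_congr fun i => by simp only [hf]; rw [tsum_mul_left]

/-- Masses of a family constant along a finite first factor. [folklore] -/
theorem summable_abs_snd (Q : Type) [Fintype Q] {coef : ℕ → ℝ} (h : Summable fun i => |coef i|) :
    Summable (fun p : Q × ℕ => |coef p.2|) ∧ ∑' p : Q × ℕ, |coef p.2| = (Fintype.card Q : ℝ) * ∑' i, |coef i| := by
  have hS : Summable (fun p : Q × ℕ => |coef p.2|) :=
    (summable_prod_of_nonneg fun p => abs_nonneg _).2 ⟨fun _ => h, Summable.of_finite⟩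
  refine ⟨hS, ?_⟩
  rw [hS.tsum_prod, tsum_fintype]
  show ∑ _b : Q, ∑' c : ℕ, |coef c| = _
  rw [Finset.sum_const, nsmul_eq_mul, Finset.card_univ]

/-! ## §2 Vector identities for the atom arguments -/

/-- `B′`-side argument: `(s/σ)(X + c) − (σ⁻¹η + (s/σ)(c − L)) = σ⁻¹(s(X + L) − η)`. [folklore] -/
theorem atom_arg_B {σi : ℝ} (hσ : σi ≠ 0) (s : ℝ) (X c L ηi : EuclideanSpace ℝ (Fin 4)) :
    (s / σi) • (X + c) - ((σi)⁻¹ • ηi + (s / σi) • (c - L)) = (σi)⁻¹ • (s • (X + L) - ηi) := by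
  ext j
  simp only [PiLp.sub_apply, PiLp.add_apply, PiLp.smul_apply, smul_eq_mul]
  field_simp
  ring

/-- `siteToE` is additive. [folklore] -/
theorem siteToE_add_eq (x k : Fin 4 → ℤ) : siteToE (d := 4) (x + k) = siteToE x + siteToE k := by
  ext i
  simp [siteToE_apply]

/-- Time components of the plaquette-centre offset and of the layer shift of a VALID orientation:
`(o_q)₀ = ℓ_q,₀ / 2` with `ℓ_q,₀ ∈ {0, 1}`. [folklore] -/
theorem centreOffset_zero_sub_layerShift {q : Fin 4 × Fin 4} (hq : q.1 < q.2) :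
    -(1 / 2 : ℝ) ≤ centreOffset q 0 - siteToE (d := 4) (layerShift q) 0 ∧
      centreOffset q 0 - siteToE (d := 4) (layerShift q) 0 ≤ 0 := by
  have h2 := two_mul_centreOffset_zero hq
  have hL : (siteToE (d := 4) (layerShift q)) 0 = if q.1 = 0 then (1 : ℝ) else 0 := by
    rw [siteToE_apply]
    unfold layerShift
    split_ifs <;> simp
  rw [hL]
  split_ifs at h2 ⊢ <;> constructor <;> linarith

/-! ## §3 S1 + S2: the cross-floor datum from the collar synthesis and the two-point floor -/

/-- **S1 + S2 of the coarse-collar chain (`CrossFloorDatum G` from the line's inputs).**  For an SU(2)-class `G`: the two-point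
floor residual `OnsetFloorQ2` gives `r`, a positive-time Schwartz `v`, `ε > 0` and, for `β ≥ β₅`, a resolution `s ∈ (0,1]` with
the torus floor `ε ≤ Q2(θv, v)`; by `coneCrossFloor_of_torusFloor` (✓ tree) this is the cone cross floor
`ε ≤ Cov_μ(B′_{v,s}∘Θ, A_{v,s})` in every odd-torus limit state.  The collar synthesis (H1) for the canonical admissible bump
`(bump, 5, 8)` — its flatness input supplied by `schwartz_flat_of_tsupport_pos` — writes `v = Σ coefᵢ b(σᵢ⁻¹(· − ηᵢ))` with
`Σ|coefᵢ| ≤ C·M_v`, `σᵢ ∈ (0,1]`, `8σᵢ ≤ ηᵢ,₀`; expanding `A_{v,s} = Σ_q Σ'_x v(sx) P_q(x)` and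
`B′_{v,s} = Σ_q Σ'_x v(s(x + ℓ_q)) P_q(x)` atom by atom (`tsum_expand_atoms`: `ℓ¹` Fubini over (site, index)) gives the two
families indexed by `{q // q.1 < q.2} × ℕ`, spacing `s/σᵢ ≥ s`, offsets `ηᵢ/σᵢ + (s/σᵢ)o_q` (height `≥ 8`) and
`ηᵢ/σᵢ + (s/σᵢ)(o_q − ℓ_q)` (height `≥ 8 − (s/σᵢ)/2`), masses `≤ 6·C·M_v`, and the per-atom clauses of `CrossFloorDatum`
follow by arithmetic. [folklore] -/
theorem crossFloorDatum_of_synthesis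
    (hSynth : ∀ (b : SchwartzMap (EuclideanSpace ℝ (Fin 4)) ℝ) (R₀ t : ℝ), AdmBump b R₀ t →
      ∃ (C : ℝ) (N : ℕ), 0 ≤ C ∧ PosTimeSynthC b C N)
    (hQ2 : OnsetFloorQ2) (G : Type) [Group G] [TopologicalSpace G] [IsTopologicalGroup G] [CompactSpace G]
    (hG : IsCompactSimpleLieGroup G) (hSU : Nonempty (G ≃ₜ* Matrix.specialUnitaryGroup (Fin 2) ℂ)) :
    letI : MeasurableSpace G := borel G
    haveI : BorelSpace G := ⟨rfl⟩
    CrossFloorDatum G := by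
  letI : MeasurableSpace G := borel G
  haveI : BorelSpace G := ⟨rfl⟩
  -- the floor datum
  obtain ⟨r, v, ε, Λ₅, β₅, hv, hε, hβ⟩ := hQ2 G hG hSU
  -- the bump, its synthesis of `v`
  have hAdm : AdmBump OnsetSkewLawRPOnsetFloorAdmBump.bump 5 8 := admBump_bump_five_eight
  obtain ⟨C, N, hC, hPTS⟩ := hSynth OnsetSkewLawRPOnsetFloorAdmBump.bump 5 8 hAdm
  obtain ⟨Mv, hMv0, hflat⟩ := schwartz_flat_of_tsupport_pos v hv N
  obtain ⟨coef, σ, η, hsum, hmass, hσ, hcol, -, hexp⟩ := hPTS v Mv hv hflat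
  obtain ⟨Mb, hMb⟩ : ∃ Mb : ℝ, ∀ u, |OnsetSkewLawRPOnsetFloorAdmBump.bump u| ≤ Mb := by
    obtain ⟨Cb, hCb⟩ := (SchwartzMap.continuous OnsetSkewLawRPOnsetFloorAdmBump.bump).bounded_above_of_compact_support hAdm.1
    exact ⟨Cb, fun u => by have h := hCb u; rwa [Real.norm_eq_abs] at h⟩
  have hMb0 : 0 ≤ Mb := (abs_nonneg _).trans (hMb 0)
  have hbR : tsupport (OnsetSkewLawRPOnsetFloorAdmBump.bump : EuclideanSpace ℝ (Fin 4) → ℝ) ⊆ {u | ∀ j, 0 ≤ u j ∧ u j ≤ 5} := hAdm.2.1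
  -- masses over `Q × ℕ`
  have hmassQ := summable_abs_snd {q : Fin 4 × Fin 4 // q.1 < q.2} hsum
  have hK : ∑' p : {q : Fin 4 × Fin 4 // q.1 < q.2} × ℕ, |coef p.2| ≤
      (Fintype.card {q : Fin 4 × Fin 4 // q.1 < q.2} : ℝ) * (C * Mv) + 1 := by
    rw [hmassQ.2]
    nlinarith [mul_le_mul_of_nonneg_left hmass (Nat.cast_nonneg (Fintype.card {q : Fin 4 × Fin 4 // q.1 < q.2}))]
  -- per-index facts
  have hσpos : ∀ i, 0 < σ i := fun i => (hσ i).1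
  have hη8 : ∀ i, 8 ≤ (σ i)⁻¹ * η i 0 := fun i => by
    rw [inv_mul_eq_div, le_div_iff₀ (hσpos i)]; exact hcol i
  refine ⟨r, OnsetSkewLawRPOnsetFloorAdmBump.bump, 5, 8, ε, (Fintype.card {q : Fin 4 × Fin 4 // q.1 < q.2} : ℝ) * (C * Mv) + 1, hAdm, hε,
    by positivity, β₅, fun β hβ' μ hμ => ?_⟩
  obtain ⟨s, hs, hs1, hfl⟩ := hβ β hβ'
  have hsσ : ∀ i, s ≤ s / σ i := fun i => by
    rw [le_div_iff₀ (hσpos i)]; nlinarith [(hσ i).2]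
  have hsσpos : ∀ i, 0 < s / σ i := fun i => div_pos hs (hσpos i)
  -- the cone cross floor (S1 + S2a)
  have hcone := (coneCrossFloor_of_torusFloor G r hs v hv hfl hμ).1
  -- the atoms
  set FA : ({q : Fin 4 × Fin 4 // q.1 < q.2} × ℕ) → LGConfig 4 G → ℝ := fun p U =>
    ∑' x : Fin 4 → ℤ, OnsetSkewLawRPOnsetFloorAdmBump.bump ((s / σ p.2) • (siteToE x + centreOffset p.1.1) -
      ((σ p.2)⁻¹ • η p.2 + (s / σ p.2) • centreOffset p.1.1)) * plane G r p.1.1 x U with hFA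
  set FB : ({q : Fin 4 × Fin 4 // q.1 < q.2} × ℕ) → LGConfig 4 G → ℝ := fun p V =>
    ∑' x : Fin 4 → ℤ, OnsetSkewLawRPOnsetFloorAdmBump.bump ((s / σ p.2) • (siteToE x + centreOffset p.1.1) -
      ((σ p.2)⁻¹ • η p.2 + (s / σ p.2) • (centreOffset p.1.1 - siteToE (layerShift p.1.1)))) * plane G r p.1.1 x V
    with hFB
  -- uniform bound on the atoms
  set B : ℝ := ((⌈(5 : ℝ) / s⌉₊ + 1 : ℕ) : ℝ) ^ 4 * Mb * r.N with hB
  have hFAb : ∀ p U, |FA p U| ≤ B := fun p U =>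
    abs_atom_le r (by norm_num) hbR hMb hs (hsσ p.2) p.1.1 _ U
  have hFBb : ∀ p V, |FB p V| ≤ B := fun p V =>
    abs_atom_le r (by norm_num) hbR hMb hs (hsσ p.2) p.1.1 _ V
  -- summability of the expansions
  have hsumF : ∀ (F : ({q : Fin 4 × Fin 4 // q.1 < q.2} × ℕ) → LGConfig 4 G → ℝ), (∀ p U, |F p U| ≤ B) →
      ∀ U, Summable (fun p => coef p.2 * F p U) ∧ ∀ q, Summable fun i => coef i * F (q, i) U := by
    intro F hF U
    refine ⟨Summable.of_norm_bounded (g := fun p => |coef p.2| * B) (hmassQ.1.mul_right B) fun p => ?_,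
      fun q => Summable.of_norm_bounded (g := fun i => |coef i| * B) (hsum.mul_right B) fun i => ?_⟩
    · rw [Real.norm_eq_abs, abs_mul]; exact mul_le_mul_of_nonneg_left (hF p U) (abs_nonneg _)
    · rw [Real.norm_eq_abs, abs_mul]; exact mul_le_mul_of_nonneg_left (hF (q, i) U) (abs_nonneg _)
  -- per-orientation expansion (generic in the base shift `L`)
  have hexpand : ∀ (q : {q : Fin 4 × Fin 4 // q.1 < q.2}) (L : Fin 4 → ℤ) (U : LGConfig 4 G),
      (∑' x : Fin 4 → ℤ, v (s • siteToE (x + L)) * plane G r q.1 x U) =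
        ∑' i, coef i * ∑' x : Fin 4 → ℤ, OnsetSkewLawRPOnsetFloorAdmBump.bump ((s / σ i) • (siteToE x + centreOffset q.1) -
          ((σ i)⁻¹ • η i + (s / σ i) • (centreOffset q.1 - siteToE L))) * plane G r q.1 x U := by
    intro q L U
    have hw : ∀ x : Fin 4 → ℤ, v (s • siteToE (x + L)) =
        ∑' i, coef i * OnsetSkewLawRPOnsetFloorAdmBump.bump ((s / σ i) • (siteToE x + centreOffset q.1) -
          ((σ i)⁻¹ • η i + (s / σ i) • (centreOffset q.1 - siteToE L))) := by
      intro x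
      rw [hexp (s • siteToE (x + L))]
      refine tsum_congr fun i => ?_
      rw [atom_arg_B (hσpos i).ne' s (siteToE x) (centreOffset q.1) (siteToE L) (η i), siteToE_add_eq]
    simp_rw [hw]
    exact tsum_expand_atoms hsum (Mb := Mb) (fun i x => hMb _)
      (fun i => atomSites 5 (s / σ i) ((σ i)⁻¹ • η i + (s / σ i) • (centreOffset q.1 - siteToE L)))
      (fun i x hx => weight_eq_zero_of_not_mem _ hbR (hsσpos i) q.1 _ hx)
      (Cmax := (⌈(5 : ℝ) / s⌉₊ + 1) ^ 4) (fun i => card_atomSites_le (by norm_num) hs (hsσ i) _)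
      (NP := r.N) (fun x => abs_plane_le_N r q.1 x U)
  -- the two global expansions
  have hA : smear G r (v : EuclideanSpace ℝ (Fin 4) → ℝ) s = fun U =>
      ∑' p : {q : Fin 4 × Fin 4 // q.1 < q.2} × ℕ, coef p.2 * FA p U := by
    funext U
    rw [smear_eq_sum_tsum_plane G r (summable_abs_schwartz_lattice v hs) U,
      (hsumF FA hFAb U).1.tsum_prod' (hsumF FA hFAb U).2, tsum_fintype]
    have h0 : siteToE (d := 4) (0 : Fin 4 → ℤ) = 0 := by ext i; simp [siteToE_apply]
    refine Finset.sum_congr rfl fun q _ => ?_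
    have h := hexpand q 0 U
    simp only [add_zero, h0, sub_zero] at h
    rw [h]
  have hBexp : smearR G r (v : EuclideanSpace ℝ (Fin 4) → ℝ) s = fun V =>
      ∑' p : {q : Fin 4 × Fin 4 // q.1 < q.2} × ℕ, coef p.2 * FB p V := by
    funext V
    rw [smearR, (hsumF FB hFBb V).1.tsum_prod' (hsumF FB hFBb V).2, tsum_fintype]
    exact Finset.sum_congr rfl fun q _ => hexpand q (layerShift q.1) V
  refine ⟨s, hs, {q : Fin 4 × Fin 4 // q.1 < q.2} × ℕ, inferInstance,
    (fun p => coef p.2), (fun p => p.1.1), (fun p => s / σ p.2),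
    (fun p => (σ p.2)⁻¹ • η p.2 + (s / σ p.2) • centreOffset p.1.1),
    {q : Fin 4 × Fin 4 // q.1 < q.2} × ℕ, inferInstance,
    (fun p => coef p.2), (fun p => p.1.1), (fun p => s / σ p.2),
    (fun p => (σ p.2)⁻¹ • η p.2 + (s / σ p.2) • (centreOffset p.1.1 - siteToE (layerShift p.1.1))),
    hmassQ.1, hK, hmassQ.1, hK, fun p => ⟨p.1.2, hsσ p.2, ?_, ?_⟩, fun p => ⟨p.1.2, hsσ p.2, ?_, ?_⟩, ?_⟩
  · -- `A` offsets: height `≥ 8`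
    have hc : 0 ≤ centreOffset p.1.1 0 := (centreOffset_time p.1.1).1
    have h0 : ((σ p.2)⁻¹ • η p.2 + (s / σ p.2) • centreOffset p.1.1) 0 =
        (σ p.2)⁻¹ * η p.2 0 + (s / σ p.2) * centreOffset p.1.1 0 := by
      simp only [PiLp.add_apply, PiLp.smul_apply, smul_eq_mul]
    rw [h0]
    nlinarith [hη8 p.2, hsσpos p.2, mul_nonneg (hsσpos p.2).le hc]
  · intro hle
    have hc : 0 ≤ centreOffset p.1.1 0 := (centreOffset_time p.1.1).1
    have h0 : ((σ p.2)⁻¹ • η p.2 + (s / σ p.2) • centreOffset p.1.1) 0 =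
        (σ p.2)⁻¹ * η p.2 0 + (s / σ p.2) * centreOffset p.1.1 0 := by
      simp only [PiLp.add_apply, PiLp.smul_apply, smul_eq_mul]
    rw [h0]
    constructor <;> nlinarith [hη8 p.2, hsσpos p.2, mul_nonneg (hsσpos p.2).le hc]
  · -- `B′` offsets: height `≥ 8 − (s/σ)/2`
    have hc := centreOffset_zero_sub_layerShift p.1.2
    have h0 : ((σ p.2)⁻¹ • η p.2 + (s / σ p.2) • (centreOffset p.1.1 - siteToE (layerShift p.1.1))) 0 =
        (σ p.2)⁻¹ * η p.2 0 + (s / σ p.2) * (centreOffset p.1.1 0 - siteToE (layerShift p.1.1) 0) := by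
      simp only [PiLp.add_apply, PiLp.smul_apply, PiLp.sub_apply, smul_eq_mul]
    rw [h0]
    nlinarith [hη8 p.2, hsσpos p.2, mul_le_mul_of_nonneg_left hc.1 (hsσpos p.2).le]
  · intro hle
    have hc := centreOffset_zero_sub_layerShift p.1.2
    have h0 : ((σ p.2)⁻¹ • η p.2 + (s / σ p.2) • (centreOffset p.1.1 - siteToE (layerShift p.1.1))) 0 =
        (σ p.2)⁻¹ * η p.2 0 + (s / σ p.2) * (centreOffset p.1.1 0 - siteToE (layerShift p.1.1) 0) := by
      simp only [PiLp.add_apply, PiLp.smul_apply, PiLp.sub_apply, smul_eq_mul]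
    rw [h0]
    constructor <;> nlinarith [hη8 p.2, hsσpos p.2, mul_le_mul_of_nonneg_left hc.1 (hsσpos p.2).le]
  · -- the floor
    have hfloor := hcone
    rw [hA, hBexp] at hfloor
    exact hfloor

/-- **`CrossFloorAtomsP` holds** (S1 + S2 of the coarse-collar chain). [folklore] -/
theorem crossFloorAtoms : CrossFloorAtomsP := fun hSynth hQ2 G _ _ _ _ hG hSU =>
  crossFloorDatum_of_synthesis hSynth hQ2 G hG hSU

/-- **The SHARED load-bearing stub `stub_coarseCollarAtomRPFloor` of LINES «FloorInheritance» (23138) and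
«MarkovFloorInheritance» (22956), BY NAME**: the registered statement `StubCoarseCollarP` (verbatim), from S1–S8.  Its own
hypotheses (collar synthesis for admissible bumps, UV quietness, the residual `OnsetFloorQ2`) remain the line's open inputs
(`stub_singleSlot`, `stub_positiveTimeSynthesisCollar`, `stub_onsetFloorQ2`); nothing else is assumed. [folklore] -/
theorem stub_coarseCollarAtomRPFloor : StubCoarseCollarP :=
  coarseCollar_of_crossFloor crossFloorAtoms

end Summit.QuantumFields.YangMills.Theorems.RPOnsetFloorCoarseCollar

end
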